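import Mathlib
import HarnessLib
import Literature.MathematicalPhysics.StatisticalMechanics.RelevantHamiltonianDerivatives
import Literature.Barriers.CriticalPhenomena.RigorousRGSmallParameterGradedNilpotentInverse

/-!
# The projection `Π₂` onto the relevant Hamiltonians ([ABKM19] Lemma 8.5, Definition 8.6)

For a functional `K` of the field on the torus `Λ = (ℤ/M)^d` and a block `B` (site set `B`, centre
`c`), the relevant Hamiltonian `Π₂K(B) ∈ M_0` is characterised by ([ABKM19] (8.29)–(8.31), Lemma 8.5)
`H(0) = K(0)`, `DH(0) = DK(0)` on the polynomial test fields `b_α`, `1 ≤ |α| ≤ ⌊d/2⌋+1`, and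
`D²H(0) = D²K(0)` on pairs of linear test fields `b_i ⊗ b_j`.  This file DEFINES `Π₂` from the
Taylor data `(K(0), DK(0), D²K(0))` — the constant and quadratic coefficients explicitly, the linear
coefficients through the inverse of the triangular matrix `B_{α'α} = Σ_{x∈B} b_{α'−α}(x)`
(`linSysMat`, file `RelevantHamiltonianDerivatives`), written as `|B|(1 + N)` with `N`
graded-nilpotent and inverted by the finite Neumann series of
`Literature.Barriers.CriticalPhenomena.RigorousRGSmallParameterGradedNilpotentInverse` — and PROVES
Lemma 8.5: the three defining identities and `Π₂ H = H` for `H ∈ M_0`.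

* `linGrade`, `linSysNil`, `linSysInv` (+ `linSysMat_mul_linSysInv`, `linSysInv_mul_linSysMat`);
* `Pi2Data c B k0 k1 k2`, **`Pi2 c B K`** `= Pi2Data c B (K 0) (fderiv ℝ K 0) (iteratedFDeriv ℝ 2 K 0)`;
* **Lemma 8.5**: `eval_Pi2Data_zero`, `evalLin_Pi2Data_polyField`, `fderiv_eval_Pi2Data_polyField`,
  `evalQuad_Pi2Data_symm`, `iteratedFDeriv_two_eval_Pi2Data`, and for `Π₂ K` with `K` of class `C²`:
  `eval_Pi2_zero`, `fderiv_eval_Pi2_polyField`, `iteratedFDeriv_two_eval_Pi2`;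
* **`Pi2_eval`** — `Π₂ (H(B,·)) = H` (uniqueness half of Lemma 8.5: `Π₂` is a projection onto `M_0`).

Hypotheses: `|B| ≠ 0` and room for `⌊d/2⌋+1` lattice steps around `B` without wrapping
(`HasRoom c x (d/2+1)` for `x ∈ B`; [ABKM19]: "`B^{++}` does not wrap around the torus").
Everything is proved; no named fact.

## References
* S. Adams, S. Buchholz, R. Kotecký, S. Müller, arXiv:1910.13564, Ch. 8.4, Lemma 8.5, Def. 8.6,
  (8.43)–(8.49) [AdamsBuchholzKoteckyMuller2019].
* D. Brydges, G. Slade, J. Stat. Phys. 159 (2015) 461–491, §2.2 (e:Ainv) [BrydgesSlade2015RGII].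
-/

noncomputable section

namespace Literature.MathematicalPhysics.StatisticalMechanics.GradientRG

open Finset Matrix
open Literature.Barriers.CriticalPhenomena.LongRangePhi4 (GradedNilpotent.neumann
  GradedNilpotent.neumann_mul GradedNilpotent.mul_neumann GradedNilpotent.pow_eq_zero)

variable {𝕜 : Type*} [NormedField 𝕜] [NormedAlgebra ℝ 𝕜] {d M : ℕ} [NeZero M]

/-! ## The triangular linear system and its Neumann inverse -/

/-- The (reversed) grading of the linear indices: `⌊d/2⌋+1 − |α|`.
[cite: AdamsBuchholzKoteckyMuller2019, Ch. 8.4 (8.48)] -/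
def linGrade (α : linIndex d) : ℕ := d / 2 + 1 - ∑ i, (α : Fin d → ℕ) i

/-- The nilpotent part `N = |B|⁻¹B − 1` of the linear system.
[cite: AdamsBuchholzKoteckyMuller2019, Ch. 8.4 (8.52)] -/
def linSysNil (c : Fin d → ZMod M) (B : Finset (Fin d → ZMod M)) :
    Matrix (linIndex d) (linIndex d) ℝ :=
  (B.card : ℝ)⁻¹ • linSysMat c B - 1

/-- The inverse `|B|⁻¹ Σ_r (−N)^r` of the linear system (finite Neumann series).
[cite: AdamsBuchholzKoteckyMuller2019, Ch. 8.4 (8.52)] -/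
def linSysInv (c : Fin d → ZMod M) (B : Finset (Fin d → ZMod M)) :
    Matrix (linIndex d) (linIndex d) ℝ :=
  (B.card : ℝ)⁻¹ • GradedNilpotent.neumann (linSysNil c B) (univ.sup (linGrade (d := d)) + 1)

omit [NeZero M] in
/-- `B = |B|(1 + N)`. [cite: AdamsBuchholzKoteckyMuller2019, Ch. 8.4 (8.48)] -/
theorem linSysMat_eq_smul {c : Fin d → ZMod M} {B : Finset (Fin d → ZMod M)} (hB : B.card ≠ 0) :
    linSysMat c B = (B.card : ℝ) • (1 + linSysNil c B) := by
  unfold linSysNil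
  have hB' : (B.card : ℝ) ≠ 0 := by exact_mod_cast hB
  rw [add_sub_cancel, smul_smul, mul_inv_cancel₀ hB', one_smul]

omit [NeZero M] in
/-- **`N` is graded-nilpotent**: `N_{α'α} ≠ 0 ⇒ |α| < |α'|`.
[cite: AdamsBuchholzKoteckyMuller2019, Ch. 8.4 (8.48)] -/
theorem linSysNil_graded {c : Fin d → ZMod M} {B : Finset (Fin d → ZMod M)} (hB : B.card ≠ 0)
    (α' α : linIndex d) (h : linSysNil c B α' α ≠ 0) : linGrade α' < linGrade α := by
  unfold linSysNil at h
  rw [Matrix.sub_apply, Matrix.smul_apply, smul_eq_mul] at h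
  have hB' : (B.card : ℝ) ≠ 0 := by exact_mod_cast hB
  by_cases heq : α' = α
  · subst heq
    rw [linSysMat_diag, Matrix.one_apply_eq, inv_mul_cancel₀ hB', sub_self] at h
    exact absurd rfl h
  · rw [Matrix.one_apply_ne heq, sub_zero] at h
    have hle : ∀ i, (α : Fin d → ℕ) i ≤ (α' : Fin d → ℕ) i := by
      by_contra hcon
      rw [linSysMat_eq_zero hcon, mul_zero] at h
      exact h rfl
    have hne : (α : Fin d → ℕ) ≠ (α' : Fin d → ℕ) := fun h' => heq (Subtype.ext h'.symm)
    obtain ⟨i, hi⟩ : ∃ i, (α : Fin d → ℕ) i < (α' : Fin d → ℕ) i := by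
      by_contra hcon
      push Not at hcon
      exact hne (funext fun i => le_antisymm (hle i) (hcon i))
    have hlt : ∑ i, (α : Fin d → ℕ) i < ∑ i, (α' : Fin d → ℕ) i :=
      Finset.sum_lt_sum (fun j _ => hle j) ⟨i, Finset.mem_univ i, hi⟩
    have h1 := (mem_linIndex.1 α'.2).2
    unfold linGrade
    omega

omit [NeZero M] in
/-- **`B · B⁻¹ = 1`.** [cite: AdamsBuchholzKoteckyMuller2019, Lemma 8.5 (Step 2)] -/
theorem linSysMat_mul_linSysInv {c : Fin d → ZMod M} {B : Finset (Fin d → ZMod M)} (hB : B.card ≠ 0) :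
    linSysMat c B * linSysInv c B = 1 := by
  have hB' : (B.card : ℝ) ≠ 0 := by exact_mod_cast hB
  unfold linSysInv
  rw [linSysMat_eq_smul hB, Matrix.smul_mul, Matrix.mul_smul, smul_smul, mul_inv_cancel₀ hB', one_smul]
  exact GradedNilpotent.mul_neumann (GradedNilpotent.pow_eq_zero (linSysNil_graded hB))

omit [NeZero M] in
/-- **`B⁻¹ · B = 1`.** [cite: AdamsBuchholzKoteckyMuller2019, Lemma 8.5 (Step 2)] -/
theorem linSysInv_mul_linSysMat {c : Fin d → ZMod M} {B : Finset (Fin d → ZMod M)} (hB : B.card ≠ 0) :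
    linSysInv c B * linSysMat c B = 1 := by
  have hB' : (B.card : ℝ) ≠ 0 := by exact_mod_cast hB
  unfold linSysInv
  rw [linSysMat_eq_smul hB, Matrix.smul_mul, Matrix.mul_smul, smul_smul, inv_mul_cancel₀ hB', one_smul]
  exact GradedNilpotent.neumann_mul (GradedNilpotent.pow_eq_zero (linSysNil_graded hB))

/-! ## Definition of `Π₂` -/

/-- `Π₂` on Taylor data `(k0, k1, k2) = (K(0), DK(0), D²K(0))`: constant coefficient `|B|⁻¹k0`,
quadratic coefficients `|B|⁻¹N_{ij}⁻¹ k2(b_i, b_j)` (`N_{ii} = 2`, `N_{ij} = 1`), linear coefficients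
`Σ_{α'} (B⁻¹)_{αα'} k1(b_{α'})`. [cite: AdamsBuchholzKoteckyMuller2019, Lemma 8.5 (8.44), (8.46)] -/
def Pi2Data (c : Fin d → ZMod M) (B : Finset (Fin d → ZMod M)) (k0 : 𝕜)
    (k1 : ((Fin d → ZMod M) → ℝ) →L[ℝ] 𝕜)
    (k2 : ((Fin d → ZMod M) → ℝ) [×2]→L[ℝ] 𝕜) : RelevantHamiltonian 𝕜 d := fun ι =>
  match ι with
  | Sum.inl _ => (B.card : ℝ)⁻¹ • k0
  | Sum.inr (Sum.inl α) => ∑ α' : linIndex d, linSysInv c B α α' • k1 (polyField c (α' : Fin d → ℕ))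
  | Sum.inr (Sum.inr q) => ((B.card : ℝ)⁻¹ * (if q.1.1 = q.1.2 then (1 / 2 : ℝ) else 1)) •
      k2 ![polyField c (Pi.single q.1.1 1), polyField c (Pi.single q.1.2 1)]

/-- **`Π₂ K(B)`** ([ABKM19] Definition 8.6): `Π₂` of the Taylor data of `K` at the zero field.
[cite: AdamsBuchholzKoteckyMuller2019, Definition 8.6] -/
def Pi2 (c : Fin d → ZMod M) (B : Finset (Fin d → ZMod M)) (K : ((Fin d → ZMod M) → ℝ) → 𝕜) :
    RelevantHamiltonian 𝕜 d :=
  Pi2Data c B (K 0) (fderiv ℝ K 0) (iteratedFDeriv ℝ 2 K 0)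

omit [NeZero M] in
/-- The constant coefficient of `Π₂`. [cite: AdamsBuchholzKoteckyMuller2019, Lemma 8.5 (8.49)] -/
@[simp] theorem Pi2Data_const (c : Fin d → ZMod M) (B : Finset (Fin d → ZMod M)) (k0 : 𝕜)
    (k1 : ((Fin d → ZMod M) → ℝ) →L[ℝ] 𝕜) (k2 : ((Fin d → ZMod M) → ℝ) [×2]→L[ℝ] 𝕜) (u : Unit) :
    Pi2Data c B k0 k1 k2 (Sum.inl u) = (B.card : ℝ)⁻¹ • k0 := rfl

omit [NeZero M] in
/-- The linear coefficients of `Π₂`. [cite: AdamsBuchholzKoteckyMuller2019, Lemma 8.5 (8.46)] -/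
@[simp] theorem Pi2Data_lin (c : Fin d → ZMod M) (B : Finset (Fin d → ZMod M)) (k0 : 𝕜)
    (k1 : ((Fin d → ZMod M) → ℝ) →L[ℝ] 𝕜) (k2 : ((Fin d → ZMod M) → ℝ) [×2]→L[ℝ] 𝕜) (α : linIndex d) :
    Pi2Data c B k0 k1 k2 (Sum.inr (Sum.inl α)) =
      ∑ α' : linIndex d, linSysInv c B α α' • k1 (polyField c (α' : Fin d → ℕ)) := rfl

omit [NeZero M] in
/-- The quadratic coefficients of `Π₂`. [cite: AdamsBuchholzKoteckyMuller2019, Lemma 8.5 (8.44)] -/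
@[simp] theorem Pi2Data_quad (c : Fin d → ZMod M) (B : Finset (Fin d → ZMod M)) (k0 : 𝕜)
    (k1 : ((Fin d → ZMod M) → ℝ) →L[ℝ] 𝕜) (k2 : ((Fin d → ZMod M) → ℝ) [×2]→L[ℝ] 𝕜) (q : quadIndex d) :
    Pi2Data c B k0 k1 k2 (Sum.inr (Sum.inr q)) =
      ((B.card : ℝ)⁻¹ * (if q.1.1 = q.1.2 then (1 / 2 : ℝ) else 1)) •
        k2 ![polyField c (Pi.single q.1.1 1), polyField c (Pi.single q.1.2 1)] := rfl

omit [NeZero M] in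
/-- `Π₂` is additive in the Taylor data. [cite: AdamsBuchholzKoteckyMuller2019, Lemma 8.5] -/
theorem Pi2Data_add (c : Fin d → ZMod M) (B : Finset (Fin d → ZMod M)) (k0 k0' : 𝕜)
    (k1 k1' : ((Fin d → ZMod M) → ℝ) →L[ℝ] 𝕜) (k2 k2' : ((Fin d → ZMod M) → ℝ) [×2]→L[ℝ] 𝕜) :
    Pi2Data c B (k0 + k0') (k1 + k1') (k2 + k2') = Pi2Data c B k0 k1 k2 + Pi2Data c B k0' k1' k2' := by
  funext ι
  rcases ι with u | α | q
  · simp [smul_add]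
  · simp [smul_add, Finset.sum_add_distrib]
  · simp [smul_add]

omit [NeZero M] in
/-- `Π₂` is homogeneous in the Taylor data. [cite: AdamsBuchholzKoteckyMuller2019, Lemma 8.5] -/
theorem Pi2Data_smul (c : Fin d → ZMod M) (B : Finset (Fin d → ZMod M)) (a : 𝕜) (k0 : 𝕜)
    (k1 : ((Fin d → ZMod M) → ℝ) →L[ℝ] 𝕜) (k2 : ((Fin d → ZMod M) → ℝ) [×2]→L[ℝ] 𝕜) :
    Pi2Data c B (a • k0) (a • k1) (a • k2) = a • Pi2Data c B k0 k1 k2 := by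
  funext ι
  rcases ι with u | α | q
  · simp
  · simp [Finset.mul_sum]
  · simp

/-! ## Lemma 8.5: the defining identities -/

section Identities

variable {c : Fin d → ZMod M} {B : Finset (Fin d → ZMod M)}

/-- **`H(0) = K(0)`** for `H = Π₂`-data. [cite: AdamsBuchholzKoteckyMuller2019, Lemma 8.5 (8.29)] -/
theorem eval_Pi2Data_zero (hB : B.card ≠ 0) (k0 : 𝕜) (k1 : ((Fin d → ZMod M) → ℝ) →L[ℝ] 𝕜)
    (k2 : ((Fin d → ZMod M) → ℝ) [×2]→L[ℝ] 𝕜) :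
    eval (Pi2Data c B k0 k1 k2) B 0 = k0 := by
  have hB' : (B.card : ℝ) ≠ 0 := by exact_mod_cast hB
  rw [eval_eq_taylor]
  simp only [map_zero, add_zero]
  rw [Pi2Data_const, smul_smul, mul_inv_cancel₀ hB', one_smul]

/-- **`ℓ_H(b_{α'}) = k1(b_{α'})`** for all linear indices `α'`.
[cite: AdamsBuchholzKoteckyMuller2019, Lemma 8.5 (8.45)] -/
theorem evalLin_Pi2Data_polyField (hB : B.card ≠ 0) (hroom : ∀ x ∈ B, HasRoom c x (d / 2 + 1))
    (k0 : 𝕜) (k1 : ((Fin d → ZMod M) → ℝ) →L[ℝ] 𝕜) (k2 : ((Fin d → ZMod M) → ℝ) [×2]→L[ℝ] 𝕜)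
    (α' : linIndex d) :
    evalLin (Pi2Data c B k0 k1 k2) B (polyField c (α' : Fin d → ℕ)) =
      k1 (polyField c (α' : Fin d → ℕ)) := by
  rw [evalLin_polyField hroom]
  simp only [Pi2Data_lin, Finset.smul_sum, smul_smul]
  rw [Finset.sum_comm]
  simp only [← Finset.sum_smul]
  have hmul : ∀ α'' : linIndex d, ∑ α : linIndex d, linSysMat c B α' α * linSysInv c B α α'' =
      (1 : Matrix (linIndex d) (linIndex d) ℝ) α' α'' := fun α'' => by
    rw [← linSysMat_mul_linSysInv hB (c := c), Matrix.mul_apply]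
  simp only [hmul, Matrix.one_apply, ite_smul, one_smul, zero_smul, Finset.sum_ite_eq, Finset.mem_univ,
    if_true]

/-- **`DH(B)(0)(b_{α'}) = k1(b_{α'})`.** [cite: AdamsBuchholzKoteckyMuller2019, Lemma 8.5 (8.30)] -/
theorem fderiv_eval_Pi2Data_polyField (hB : B.card ≠ 0) (hroom : ∀ x ∈ B, HasRoom c x (d / 2 + 1))
    (k0 : 𝕜) (k1 : ((Fin d → ZMod M) → ℝ) →L[ℝ] 𝕜) (k2 : ((Fin d → ZMod M) → ℝ) [×2]→L[ℝ] 𝕜)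
    (α' : linIndex d) :
    fderiv ℝ (fun φ : (Fin d → ZMod M) → ℝ => eval (Pi2Data c B k0 k1 k2) B φ) 0
      (polyField c (α' : Fin d → ℕ)) = k1 (polyField c (α' : Fin d → ℕ)) := by
  rw [fderiv_eval_zero, evalLin_Pi2Data_polyField hB hroom]

/-- **`Q_H(b_i,b_j) + Q_H(b_j,b_i) = k2(b_i,b_j)`** for symmetric data `k2`.
[cite: AdamsBuchholzKoteckyMuller2019, Lemma 8.5 (8.43)–(8.44)] -/
theorem evalQuad_Pi2Data_symm (hB : B.card ≠ 0) (hroom : ∀ x ∈ B, HasRoom c x 1) (k0 : 𝕜)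
    (k1 : ((Fin d → ZMod M) → ℝ) →L[ℝ] 𝕜) (k2 : ((Fin d → ZMod M) → ℝ) [×2]→L[ℝ] 𝕜) (i j : Fin d)
    (hsymm : k2 ![polyField c (Pi.single i 1), polyField c (Pi.single j 1)] =
      k2 ![polyField c (Pi.single j 1), polyField c (Pi.single i 1)]) :
    evalQuad (Pi2Data c B k0 k1 k2) B (polyField c (Pi.single i 1)) (polyField c (Pi.single j 1)) +
      evalQuad (Pi2Data c B k0 k1 k2) B (polyField c (Pi.single j 1)) (polyField c (Pi.single i 1)) =
      k2 ![polyField c (Pi.single i 1), polyField c (Pi.single j 1)] := by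
  have hB' : (B.card : ℝ) ≠ 0 := by exact_mod_cast hB
  rw [evalQuad_polyField_single hroom, evalQuad_polyField_single hroom]
  rcases lt_trichotomy i j with hij | rfl | hji
  · rw [dif_pos hij.le, dif_neg (not_le.2 hij), add_zero, Pi2Data_quad]
    simp only [if_neg hij.ne, smul_smul, mul_one, mul_inv_cancel₀ hB', one_smul]
  · rw [dif_pos le_rfl, Pi2Data_quad]
    simp only [if_true, smul_smul, ← add_smul]
    rw [show (B.card : ℝ) * ((B.card : ℝ)⁻¹ * (1 / 2)) + (B.card : ℝ) * ((B.card : ℝ)⁻¹ * (1 / 2)) = 1 by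
      field_simp; ring, one_smul]
  · rw [dif_neg (not_le.2 hji), dif_pos hji.le, zero_add, Pi2Data_quad, hsymm]
    simp only [if_neg hji.ne, smul_smul, mul_one, mul_inv_cancel₀ hB', one_smul]

/-- **`D²H(B)(0)(b_i,b_j) = k2(b_i,b_j)`** for symmetric data `k2`.
[cite: AdamsBuchholzKoteckyMuller2019, Lemma 8.5 (8.31)] -/
theorem iteratedFDeriv_two_eval_Pi2Data (hB : B.card ≠ 0) (hroom : ∀ x ∈ B, HasRoom c x 1)
    (k0 : 𝕜) (k1 : ((Fin d → ZMod M) → ℝ) →L[ℝ] 𝕜) (k2 : ((Fin d → ZMod M) → ℝ) [×2]→L[ℝ] 𝕜)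
    (i j : Fin d)
    (hsymm : k2 ![polyField c (Pi.single i 1), polyField c (Pi.single j 1)] =
      k2 ![polyField c (Pi.single j 1), polyField c (Pi.single i 1)]) :
    iteratedFDeriv ℝ 2 (fun φ : (Fin d → ZMod M) → ℝ => eval (Pi2Data c B k0 k1 k2) B φ) 0
      ![polyField c (Pi.single i 1), polyField c (Pi.single j 1)] =
      k2 ![polyField c (Pi.single i 1), polyField c (Pi.single j 1)] := by
  rw [iteratedFDeriv_two_eval, evalQuad_Pi2Data_symm hB hroom k0 k1 k2 i j hsymm]

/-- The second derivative of a `C²` functional is symmetric on the test fields.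
[cite: AdamsBuchholzKoteckyMuller2019, Lemma 8.5 (polarisation remark)] -/
theorem iteratedFDeriv_two_symm {K : ((Fin d → ZMod M) → ℝ) → 𝕜} (hK : ContDiff ℝ 2 K)
    (φ ξ η : (Fin d → ZMod M) → ℝ) :
    iteratedFDeriv ℝ 2 K φ ![ξ, η] = iteratedFDeriv ℝ 2 K φ ![η, ξ] := by
  rw [iteratedFDeriv_two_apply, iteratedFDeriv_two_apply]
  have hs : IsSymmSndFDerivAt ℝ K φ := hK.contDiffAt.isSymmSndFDerivAt (by simp)
  exact hs ξ η

/-- **Lemma 8.5 for `Π₂K`, constant part**: `(Π₂K)(B)(0) = K(0)`.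
[cite: AdamsBuchholzKoteckyMuller2019, Lemma 8.5 (8.29)] -/
theorem eval_Pi2_zero (hB : B.card ≠ 0) (K : ((Fin d → ZMod M) → ℝ) → 𝕜) :
    eval (Pi2 c B K) B 0 = K 0 :=
  eval_Pi2Data_zero hB _ _ _

/-- **Lemma 8.5 for `Π₂K`, linear part**: `D(Π₂K)(B)(0)(b_α) = DK(0)(b_α)`.
[cite: AdamsBuchholzKoteckyMuller2019, Lemma 8.5 (8.30)] -/
theorem fderiv_eval_Pi2_polyField (hB : B.card ≠ 0) (hroom : ∀ x ∈ B, HasRoom c x (d / 2 + 1))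
    (K : ((Fin d → ZMod M) → ℝ) → 𝕜) (α : linIndex d) :
    fderiv ℝ (fun φ : (Fin d → ZMod M) → ℝ => eval (Pi2 c B K) B φ) 0 (polyField c (α : Fin d → ℕ)) =
      fderiv ℝ K 0 (polyField c (α : Fin d → ℕ)) :=
  fderiv_eval_Pi2Data_polyField hB hroom _ _ _ α

/-- **Lemma 8.5 for `Π₂K`, quadratic part**: `D²(Π₂K)(B)(0)(b_i,b_j) = D²K(0)(b_i,b_j)` for `K ∈ C²`.
[cite: AdamsBuchholzKoteckyMuller2019, Lemma 8.5 (8.31)] -/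
theorem iteratedFDeriv_two_eval_Pi2 (hB : B.card ≠ 0) (hroom : ∀ x ∈ B, HasRoom c x 1)
    {K : ((Fin d → ZMod M) → ℝ) → 𝕜} (hK : ContDiff ℝ 2 K) (i j : Fin d) :
    iteratedFDeriv ℝ 2 (fun φ : (Fin d → ZMod M) → ℝ => eval (Pi2 c B K) B φ) 0
      ![polyField c (Pi.single i 1), polyField c (Pi.single j 1)] =
      iteratedFDeriv ℝ 2 K 0 ![polyField c (Pi.single i 1), polyField c (Pi.single j 1)] :=
  iteratedFDeriv_two_eval_Pi2Data hB hroom _ _ _ i j (iteratedFDeriv_two_symm hK 0 _ _)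

/-! ## `Π₂` is a projection onto `M_0` -/

/-- **`Π₂(H(B,·)) = H`** for every relevant Hamiltonian `H` (the uniqueness half of Lemma 8.5).
[cite: AdamsBuchholzKoteckyMuller2019, Lemma 8.5 (uniqueness)] -/
theorem Pi2_eval (hB : B.card ≠ 0) (hroom : ∀ x ∈ B, HasRoom c x (d / 2 + 1))
    (H : RelevantHamiltonian 𝕜 d) :
    Pi2 c B (fun φ : (Fin d → ZMod M) → ℝ => eval H B φ) = H := by
  have hB' : (B.card : ℝ) ≠ 0 := by exact_mod_cast hB
  have hroom1 : ∀ x ∈ B, HasRoom c x 1 := fun x hx => (hroom x hx).mono (by omega)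
  funext ι
  unfold Pi2
  rcases ι with u | α | q
  · rw [Pi2Data_const]
    change (B.card : ℝ)⁻¹ • eval H B 0 = H (Sum.inl u)
    rw [eval_eq_taylor]
    simp only [map_zero, add_zero]
    rw [smul_smul, inv_mul_cancel₀ hB', one_smul]
  · rw [Pi2Data_lin]
    simp only [fderiv_eval_zero, evalLin_polyField hroom, Finset.smul_sum, smul_smul]
    rw [Finset.sum_comm]
    simp only [← Finset.sum_smul]
    have hmul : ∀ α'' : linIndex d, ∑ α' : linIndex d, linSysInv c B α α' * linSysMat c B α' α'' =
        (1 : Matrix (linIndex d) (linIndex d) ℝ) α α'' := fun α'' => by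
      rw [← linSysInv_mul_linSysMat hB (c := c), Matrix.mul_apply]
    simp only [hmul, Matrix.one_apply, ite_smul, one_smul, zero_smul, Finset.sum_ite_eq,
      Finset.mem_univ, if_true]
  · rw [Pi2Data_quad, iteratedFDeriv_two_eval, evalQuad_polyField_single hroom1,
      evalQuad_polyField_single hroom1]
    obtain ⟨⟨i, j⟩, hij⟩ := q
    simp only at hij ⊢
    by_cases h : i = j
    · subst h
      rw [dif_pos le_rfl, if_pos rfl, ← two_smul ℝ, smul_smul, smul_smul]
      rw [show (B.card : ℝ)⁻¹ * (1 / 2) * 2 * (B.card : ℝ) = 1 by field_simp, one_smul]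
    · have hlt : i < j := lt_of_le_of_ne hij h
      rw [dif_pos hij, dif_neg (not_le.2 hlt), add_zero, if_neg h, mul_one, smul_smul,
        inv_mul_cancel₀ hB', one_smul]

end Identities

end Literature.MathematicalPhysics.StatisticalMechanics.GradientRG

end
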